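import Mathlib
import Summits.HodgeConjecture.HodgeConjecture.Theorems.HodgeLocusCensusInclusionPowers

/-!
# Gottlieb–Kantor beyond characteristic `0`: the `j`-sets-versus-`(j+c)`-sets inclusion matrix of an `n`-set has full rank over EVERY field in
which `1, 2, …, n` are non-zero — in particular in every characteristic `p > n` (ENGINE B gen 53, PROBE 11; successor material for O-114-4)

certified instances and evidence bearing on the general Hodge conjecture; no claim.

ENGINE B gen 53 PROBE 11 of the HODGE-LOCUS COMPONENT CENSUS (pub-hlocus; evidence class, helper of stmt-HodgeConjecture-16267; no census number
changes; nothing about HC): theorem-only, definition-free; imports `Mathlib` and anchor 204 `Theorems/HodgeLocusCensusInclusionPowers.lean`, whose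
characteristic-free lemmas `downOp_upOp_pow` (the `sl₂` rule for powers), `downOp_pow_rank`, `downOp_pow_comp_compl`, `incl_pow_mulVec` and Stanley's
`upOp`/`downOp` bookkeeping (`Literature/Combinatorics/Posets/BooleanOrderRaising.lean`) are used BY NAME; nothing is restated.

WHAT IS GENERALISED. Anchor 204 proves `rank W^{(c)}_j = min (C(n,j), C(n,j+c))` under `[CharZero K]`; the ONLY place characteristic `0` enters its proof is
the non-vanishing of the scalars `(c'+1)(n − 2i' − c')` met in the double induction, and every such scalar is a product of two natural numbers in `[1, n]`.
This file runs the same induction under the hypothesis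
`(hK : ∀ m : ℕ, 0 < m → m ≤ Fintype.card α → (m : K) ≠ 0)` — "`1, …, n` are units of `K`":
* `upOp_pow_eq_zero_imp_of` — `U^c` is one-to-one on `V_i` for `2i + c ≤ n`; `downOp_pow_eq_zero_imp_of` — `D^c` on `V_j` for `n + c ≤ 2j`;
* `incl_pow_mulVecLin_injective_of`, `rank_incl_pow_into_of` (`n ≤ 2j + c`: rank `= C(n,j+c)`), `rank_incl_pow_onto_of` (`2j + c ≤ n`: rank `= C(n,j)`),
  **`rank_incl_pow_of`: `rank W^{(c)}_j = min (C(n,j), C(n,j+c))`** under `hK`;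
* **`rank_incl_pow_of_card_lt_char`**: the same for `[CharP K p]` with `Fintype.card α < p` (no primality needed: `p ∣ m` with `0 < m < p` is impossible);
  (`[CharZero K]` satisfies `hK` by `Nat.cast_ne_zero`, so anchor 204's `rank_incl_pow` is the special case — not restated here);
READING (the positive-characteristic exceptions table, `EXCEPTIONS-TABLE-g53.md`): Wilson (1990) shows `rank_p W_{t,k'}` is full already for
`p > k'`; the weaker threshold `p > n` proved here is what the census needs: combined with PROBE 9's block reduction (LW)
(`…UnitColumnRankLevelsChar.rank_mulDeltaPow_levels_eq_sum`: blocks `c! • W_{t,t+c}` on the `k − s ≤ k` points where the label vanishes) it gives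
**THEOREM L verbatim over every field of characteristic `p > k`** — i.e. the exceptions table at `k` variables is supported on the primes `p ≤ k`
(first cells observed at `k = p + 1`). That corollary needs both files in the tree and is recorded as successor material
(`gen53/probe11/P11_census_concat.lean`, checked by concatenation), not stated here.
-/

set_option linter.dupNamespace false
set_option autoImplicit false

namespace Summit.HodgeConjecture.HodgeConjecture.HodgeLocus.Census.InclusionPowersChar

open Literature.Combinatorics.Posets.BooleanOrderRaising (upOp downOp downOp_rank downOp_rank_zero)
open Summit.HodgeConjecture.HodgeConjecture.HodgeLocus.Census.InclusionPowers (downOp_upOp_pow downOp_pow_rank downOp_pow_comp_compl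
  incl_pow_mulVec)

/-! ## Part A — operator injectivity under "`1, …, n` are units" -/

section Operators

variable {K : Type*} [Field K] {α : Type*} [Fintype α] [DecidableEq α]

omit [DecidableEq α] in
/-- the scalar `(c+1)(n − 2i − c)` is non-zero as soon as `1, …, n` are non-zero in `K` and `2i + c + 1 ≤ n`
(both factors are natural numbers in `[1, n]`). -/
theorem scalar_ne_zero_of (hK : ∀ m : ℕ, 0 < m → m ≤ Fintype.card α → (m : K) ≠ 0) {i c : ℕ} (h : 2 * i + c + 1 ≤ Fintype.card α) :
    (((c + 1 : ℕ) : K) * ((Fintype.card α : K) - 2 * (i : K) - (c : K))) ≠ 0 := by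
  have h1 : ((Fintype.card α : K) - 2 * (i : K) - (c : K)) = ((Fintype.card α - 2 * i - c : ℕ) : K) := by
    rw [Nat.cast_sub (by omega), Nat.cast_sub (by omega), Nat.cast_mul, Nat.cast_two]
  rw [h1]
  exact mul_ne_zero (hK _ (by omega) (by omega)) (hK _ (by omega) (by omega))

/-- **`U^c` is one-to-one on `V_i` when `2i + c ≤ n`**, over any field in which `1, …, n` are units (anchor 204's double induction, the scalar
cancelled through `scalar_ne_zero_of`). -/
theorem upOp_pow_eq_zero_imp_of (hK : ∀ m : ℕ, 0 < m → m ≤ Fintype.card α → (m : K) ≠ 0) :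
    ∀ (i c : ℕ) (f : Finset α → K), (∀ S, S.card ≠ i → f S = 0) → 2 * i + c ≤ Fintype.card α →
      (upOp (K := K) (α := α) ^ c) f = 0 → f = 0 := by
  have e1 : ∀ (c : ℕ) (x : Finset α → K), upOp ((upOp (K := K) (α := α) ^ (c + 1)) x) = (upOp (K := K) (α := α) ^ (c + 1 + 1)) x :=
    fun c x => by rw [pow_succ' _ (c + 1), Module.End.mul_apply]
  have e0 : ∀ (c : ℕ) (x : Finset α → K), upOp ((upOp (K := K) (α := α) ^ c) x) = (upOp (K := K) (α := α) ^ (c + 1)) x :=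
    fun c x => by rw [pow_succ' _ c, Module.End.mul_apply]
  intro i
  induction i with
  | zero =>
    intro c
    induction c with
    | zero => intro f _ _ h0; rwa [pow_zero, Module.End.one_apply] at h0
    | succ c ihc =>
      intro f hf hle h0
      have hD : downOp (K := K) (α := α) f = 0 := downOp_rank_zero hf
      have key := downOp_upOp_pow hf c
      rw [h0, map_zero, hD, map_zero, zero_add] at key
      have hs := scalar_ne_zero_of (K := K) hK (i := 0) (c := c) (by omega)
      have hUc : (upOp (K := K) (α := α) ^ c) f = 0 := (smul_eq_zero.mp key.symm).resolve_left hs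
      exact ihc f hf (by omega) hUc
  | succ i ihi =>
    intro c
    induction c with
    | zero => intro f _ _ h0; rwa [pow_zero, Module.End.one_apply] at h0
    | succ c ihc =>
      intro f hf hle h0
      have hDf : ∀ S : Finset α, S.card ≠ i → downOp (K := K) (α := α) f S = 0 := fun S hS => downOp_rank hf S hS
      have key := downOp_upOp_pow hf c
      rw [h0, map_zero] at key
      have hU2 : (upOp (K := K) (α := α) ^ (c + 1 + 1)) (downOp f) = 0 := by
        have h1 := congrArg (upOp (K := K) (α := α)) key
        rw [map_zero, map_add, map_smul, e1, e0, h0, smul_zero, add_zero] at h1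
        exact h1.symm
      have hD0 : downOp (K := K) (α := α) f = 0 := ihi (c + 1 + 1) (downOp f) hDf (by omega) hU2
      rw [hD0, map_zero, zero_add] at key
      have hs := scalar_ne_zero_of (K := K) hK (i := i + 1) (c := c) (by omega)
      have hUc : (upOp (K := K) (α := α) ^ c) f = 0 := (smul_eq_zero.mp key.symm).resolve_left hs
      exact ihc f hf (by omega) hUc

/-- **`D^c` is one-to-one on `V_j` when `n + c ≤ 2j`**, same hypothesis (transport along complementation, anchor 204's `downOp_pow_comp_compl`). -/
theorem downOp_pow_eq_zero_imp_of (hK : ∀ m : ℕ, 0 < m → m ≤ Fintype.card α → (m : K) ≠ 0) {f : Finset α → K} {j : ℕ} (c : ℕ)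
    (hf : ∀ S, S.card ≠ j → f S = 0) (hj : Fintype.card α + c ≤ 2 * j) (h : (downOp (K := K) (α := α) ^ c) f = 0) : f = 0 := by
  by_cases hjn : j ≤ Fintype.card α
  · set g : Finset α → K := fun T => f Tᶜ with hg
    have hg' : ∀ S : Finset α, S.card ≠ Fintype.card α - j → g S = 0 := by
      intro S hS
      apply hf
      intro hc
      apply hS
      have h1 := Finset.card_compl S
      have h2 := Finset.card_le_univ S
      omega
    have hfg : (fun T => g Tᶜ) = f := funext fun T => by simp only [hg, compl_compl]
    have hU : (upOp (K := K) (α := α) ^ c) g = 0 := by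
      have h1 := downOp_pow_comp_compl g c
      rw [hfg, h] at h1
      funext T
      have h2 := congrFun h1 Tᶜ
      simp only [hg, Pi.zero_apply, compl_compl] at h2
      rw [hg]
      exact h2.symm
    have hg0 : g = 0 := upOp_pow_eq_zero_imp_of hK (Fintype.card α - j) c g hg' (by omega) hU
    rw [← hfg, hg0]
    rfl
  · funext S
    exact hf S (by have := Finset.card_le_univ S; omega)

end Operators

/-! ## Part B — the inclusion matrices `W^{(c)}_j` under "`1, …, n` are units", and in characteristic `p > n` -/

section Matrices

variable (K : Type*) [Field K] {α : Type*} [Fintype α] [DecidableEq α]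

/-- **INTO**: `x ↦ W^{(c)}_j · x` is one-to-one when `n ≤ 2j + c` (via `c! · W x = D^c x̃`, anchor 204's `incl_pow_mulVec`; note that `c!` need
not be a unit — `W x = 0` already forces `D^c x̃ = 0`). -/
theorem incl_pow_mulVecLin_injective_of (hK : ∀ m : ℕ, 0 < m → m ≤ Fintype.card α → (m : K) ≠ 0) {j c : ℕ}
    (hj : Fintype.card α ≤ 2 * j + c) :
    Function.Injective (Matrix.of fun (T : {S : Finset α // S.card = j}) (S : {S : Finset α // S.card = j + c}) =>
        if T.1 ⊆ S.1 then (1 : K) else 0).mulVecLin := by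
  rw [← LinearMap.ker_eq_bot, LinearMap.ker_eq_bot']
  intro x hx
  rw [Matrix.mulVecLin_apply] at hx
  set xt : Finset α → K := fun U => if h : U.card = j + c then x ⟨U, h⟩ else 0 with hxt
  have hxt' : ∀ U : Finset α, U.card ≠ j + c → xt U = 0 := fun U hU => by simp only [hxt, dif_neg hU]
  have hD : (downOp (K := K) (α := α) ^ c) xt = 0 := by
    funext U
    rw [Pi.zero_apply]
    by_cases hU : U.card = j
    · have h1 := incl_pow_mulVec K j c x ⟨U, hU⟩
      rw [hx, Pi.zero_apply, mul_zero] at h1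
      exact h1.symm
    · exact downOp_pow_rank c hxt' U hU
  have h0 : xt = 0 := downOp_pow_eq_zero_imp_of hK c hxt' (by omega) hD
  funext S
  have h1 := congrFun h0 S.1
  simp only [hxt, dif_pos S.2, Subtype.coe_eta, Pi.zero_apply] at h1
  exact h1

/-- **Rank, INTO regime** `n ≤ 2j + c`: `rank W^{(c)}_j = C(n, j+c)`. -/
theorem rank_incl_pow_into_of (hK : ∀ m : ℕ, 0 < m → m ≤ Fintype.card α → (m : K) ≠ 0) (j c : ℕ) (hj : Fintype.card α ≤ 2 * j + c) :
    (Matrix.of fun (T : {S : Finset α // S.card = j}) (S : {S : Finset α // S.card = j + c}) =>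
        if T.1 ⊆ S.1 then (1 : K) else 0).rank = (Fintype.card α).choose (j + c) := by
  rw [Matrix.rank, LinearMap.finrank_range_of_inj (incl_pow_mulVecLin_injective_of K hK hj), Module.finrank_fintype_fun_eq_card,
    Fintype.card_finset_len]

/-- **Rank, ONTO regime** `2j + c ≤ n`: `rank W^{(c)}_j = C(n, j)` (transpose + complement reindex, as in anchor 204). -/
theorem rank_incl_pow_onto_of (hK : ∀ m : ℕ, 0 < m → m ≤ Fintype.card α → (m : K) ≠ 0) (j c : ℕ) (hj : 2 * j + c ≤ Fintype.card α) :
    (Matrix.of fun (T : {S : Finset α // S.card = j}) (S : {S : Finset α // S.card = j + c}) =>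
        if T.1 ⊆ S.1 then (1 : K) else 0).rank = (Fintype.card α).choose j := by
  have hjc : j + c ≤ Fintype.card α := by omega
  let e : Finset α ≃ Finset α := ⟨compl, compl, compl_compl, compl_compl⟩
  let eR : {S : Finset α // S.card = j + c} ≃ {R : Finset α // R.card = Fintype.card α - j - c} :=
    e.subtypeEquiv fun S => by
      show S.card = j + c ↔ Sᶜ.card = Fintype.card α - j - c
      rw [Finset.card_compl]; have := Finset.card_le_univ S; omega
  let eC : {T : Finset α // T.card = j} ≃ {Q : Finset α // Q.card = Fintype.card α - j - c + c} :=
    e.subtypeEquiv fun T => by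
      show T.card = j ↔ Tᶜ.card = Fintype.card α - j - c + c
      rw [Finset.card_compl]; have := Finset.card_le_univ T; omega
  have hre : Matrix.reindex eR.symm eC.symm (Matrix.of fun (R : {R : Finset α // R.card = Fintype.card α - j - c})
      (Q : {Q : Finset α // Q.card = Fintype.card α - j - c + c}) => if R.1 ⊆ Q.1 then (1 : K) else 0) =
      Matrix.transpose (Matrix.of fun (T : {S : Finset α // S.card = j}) (S : {S : Finset α // S.card = j + c}) =>
        if T.1 ⊆ S.1 then (1 : K) else 0) := by
    ext S T
    simp only [Matrix.reindex_apply, Matrix.submatrix_apply, Matrix.transpose_apply, Matrix.of_apply, Equiv.symm_symm]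
    have h1 : (eR S).1 = S.1ᶜ := rfl
    have h2 : (eC T).1 = T.1ᶜ := rfl
    rw [h1, h2]
    exact if_congr Finset.compl_subset_compl rfl rfl
  rw [← Matrix.rank_transpose, ← hre, Matrix.rank_reindex, rank_incl_pow_into_of K hK (Fintype.card α - j - c) c (by omega),
    show Fintype.card α - j - c + c = Fintype.card α - j by omega, Nat.choose_symm (by omega : j ≤ Fintype.card α)]

/-- **Gottlieb–Kantor over any field in which `1, …, n` are units**: `rank W^{(c)}_j = min (C(n,j), C(n,j+c))`. -/
theorem rank_incl_pow_of (hK : ∀ m : ℕ, 0 < m → m ≤ Fintype.card α → (m : K) ≠ 0) (j c : ℕ) :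
    (Matrix.of fun (T : {S : Finset α // S.card = j}) (S : {S : Finset α // S.card = j + c}) =>
        if T.1 ⊆ S.1 then (1 : K) else 0).rank = min ((Fintype.card α).choose j) ((Fintype.card α).choose (j + c)) := by
  by_cases h : 2 * j + c ≤ Fintype.card α
  · have h1 := rank_incl_pow_onto_of K hK j c h
    have h2 := Matrix.rank_le_card_width (Matrix.of fun (T : {S : Finset α // S.card = j}) (S : {S : Finset α // S.card = j + c}) =>
      if T.1 ⊆ S.1 then (1 : K) else 0)
    rw [Fintype.card_finset_len, h1] at h2
    rw [h1, eq_comm, min_eq_left_iff]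
    exact h2
  · have h1 := rank_incl_pow_into_of K hK j c (by omega)
    have h2 := Matrix.rank_le_card_height (Matrix.of fun (T : {S : Finset α // S.card = j}) (S : {S : Finset α // S.card = j + c}) =>
      if T.1 ⊆ S.1 then (1 : K) else 0)
    rw [Fintype.card_finset_len, h1] at h2
    rw [h1, eq_comm, min_eq_right_iff]
    exact h2

/-- **Characteristic `p > n`**: for `[CharP K p]` with `Fintype.card α < p`, `rank W^{(c)}_j = min (C(n,j), C(n,j+c))` — the inclusion matrices of
an `n`-set have NO modular rank drop at any prime exceeding `n` (Wilson's sharper threshold is `p > j + c`). -/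
theorem rank_incl_pow_of_card_lt_char (p : ℕ) [CharP K p] (hp : Fintype.card α < p) (j c : ℕ) :
    (Matrix.of fun (T : {S : Finset α // S.card = j}) (S : {S : Finset α // S.card = j + c}) =>
        if T.1 ⊆ S.1 then (1 : K) else 0).rank = min ((Fintype.card α).choose j) ((Fintype.card α).choose (j + c)) := by
  refine rank_incl_pow_of K (fun m hm hmn => ?_) j c
  rw [Ne, CharP.cast_eq_zero_iff K p]
  intro hdvd
  exact absurd (Nat.le_of_dvd hm hdvd) (by omega)

/-- the `2 × 2`-type witness that SOME hypothesis is needed: over a field with `(2 : K) = 0` the `1`-sets-versus-`2`-sets matrix of a `3`-set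
has rank `2 < 3 = min (C(3,1), C(3,2))` is NOT claimed here (it is PROBE 9's (W2) at `t = 1`); what this file records is the positive statement
at every prime `p > n`. For `n = 0, 1` the hypothesis `hK` is vacuous / reads `(1 : K) ≠ 0`, so small sets never drop rank: -/
theorem rank_incl_pow_of_card_le_one (h1 : Fintype.card α ≤ 1) (j c : ℕ) :
    (Matrix.of fun (T : {S : Finset α // S.card = j}) (S : {S : Finset α // S.card = j + c}) =>
        if T.1 ⊆ S.1 then (1 : K) else 0).rank = min ((Fintype.card α).choose j) ((Fintype.card α).choose (j + c)) :=
  rank_incl_pow_of K (fun m hm hmn => by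
    have hm1 : m = 1 := by omega
    subst hm1; rw [Nat.cast_one]; exact one_ne_zero) j c

end Matrices

end Summit.HodgeConjecture.HodgeConjecture.HodgeLocus.Census.InclusionPowersChar
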